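import Summits.ValiantsHypothesis.ValiantsHypothesis.Theorems.DivisionGapZeroOneTransferTriWalkDefs
import HarnessLib

/-!
# Winding numbers of closed walks on the triangular lattice, I: support, shoelace, jumps, locality

First proof file for the registered stub `stub_pickParity` of line `charged-uncharged` of crux
`ZeroOneTransfer` (stmt-ValiantsHypothesis-5066, route DivisionGap) — Pick's theorem mod 4 for simple
closed walks on the triangular lattice, the lattice-topology input of Kasteleyn's theorem for
Valiant's rhombus dimers.  Vocabulary: `Theorems/DivisionGapZeroOneTransferTriWalkDefs.lean`
(`TriWalk`, `W₁`, `W₂`, `cnt`, `shoelace`, `faceSum`).  This file is the triangular analogue of the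
first half of `Literature/Probability/LatticeModels/LatticeLoopWinding.lean` (square lattice):

* the winding numbers `W₁ a b`, `W₂ a b` (about the centroids of the two triangles of the unit square
  `(a,b)`) vanish off the box of faces spanned by the walk, and **sum to the shoelace sum**
  (`sum_W_box_eq_shoelace`, `sum_W_eq_shoelace`: each triangle has area `½`);
* **summation by parts** (`W₁_eq_neg_sum`, `W₂_eq_neg_sum`): the same winding numbers counted on
  the upward ray (`max`/`min` of the ordinates);
* the **jumps** across the three kinds of edges are the net traversal counts (`W₁_sub_W₂_left`,
  `W₁_sub_W₂_below`, `W₁_sub_W₂_diag`);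
* hence **off the walk the six triangles around a lattice point carry one winding number**
  (`W_around_eq_of_notMem`, `faceSum_eq_of_notMem`: the angle-weighted face sum is `8 W₁`) and
  **off-walk lattice neighbours carry the same winding number** (`W₁_eq_of_notMem`, registered
  sub-goal of the crux item).
[cite: Kenyon2009, §3.3] [cite: Kasteleyn1961]
-/

namespace Summit.ValiantsHypothesis.ValiantsHypothesis.Theorems.DivisionGapZeroOneTransfer

-- the single-problem summit's namespace `Summit.ValiantsHypothesis.ValiantsHypothesis` repeats
set_option linter.dupNamespace false

open Finset Literature.Probability.LatticeModels

namespace TriWalk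

variable {ℓ : ℕ} (c : TriWalk ℓ)

/-! ### Periodicity and steps -/

/-- Periodicity, iterated. [folklore] -/
theorem v_add_mul (j m : ℕ) : c.v (j + m * ℓ) = c.v j := by
  induction m with
  | zero => simp
  | succ m ih => rw [Nat.succ_mul, ← Nat.add_assoc, c.periodic, ih]

/-- The vertex only depends on the index mod `ℓ`. [folklore] -/
theorem v_mod (j : ℕ) : c.v (j % ℓ) = c.v j := by
  conv_rhs => rw [← Nat.mod_add_div j ℓ, Nat.mul_comm]
  exact (c.v_add_mul (j % ℓ) (j / ℓ)).symm

/-- Indices congruent mod `ℓ` carry the same vertex. [folklore] -/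
theorem v_eq_of_mod_eq {i j : ℕ} (h : i % ℓ = j % ℓ) : c.v i = c.v j := by
  rw [← c.v_mod i, h, c.v_mod]

/-- `v ℓ = v 0`. [folklore] -/
theorem v_ℓ : c.v ℓ = c.v 0 := by simpa using c.periodic 0

/-- `v (ℓ + 1) = v 1`. [folklore] -/
theorem v_ℓ_succ : c.v (ℓ + 1) = c.v 1 := by simpa [Nat.add_comm] using c.periodic 1

/-- The steps in coordinates: `(Δx, Δy) ∈ {(1,0), (-1,0), (0,1), (0,-1), (1,-1), (-1,1)}`. [folklore] -/
theorem step_coord (j : ℕ) :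
    ((c.v (j + 1)).1 = (c.v j).1 + 1 ∧ (c.v (j + 1)).2 = (c.v j).2) ∨
    ((c.v (j + 1)).1 = (c.v j).1 - 1 ∧ (c.v (j + 1)).2 = (c.v j).2) ∨
    ((c.v (j + 1)).1 = (c.v j).1 ∧ (c.v (j + 1)).2 = (c.v j).2 + 1) ∨
    ((c.v (j + 1)).1 = (c.v j).1 ∧ (c.v (j + 1)).2 = (c.v j).2 - 1) ∨
    ((c.v (j + 1)).1 = (c.v j).1 + 1 ∧ (c.v (j + 1)).2 = (c.v j).2 - 1) ∨
    ((c.v (j + 1)).1 = (c.v j).1 - 1 ∧ (c.v (j + 1)).2 = (c.v j).2 + 1) := by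
  rcases c.step j with h | h | h | h | h | h <;>
    simp only [Prod.ext_iff, Prod.fst_add, Prod.snd_add] at h <;> omega

/-! ### Vanishing away from the walk; the shoelace sum as the sum of all winding numbers -/

/-- No vertex strictly to the right: `W₁ = 0`. [folklore] -/
theorem W₁_eq_zero_of_fst_le {a b : ℤ} (h : ∀ j, (c.v j).1 ≤ a) : c.W₁ a b = 0 := by
  unfold W₁
  exact sum_eq_zero fun j _ => by
    rw [indZ_of_neg (not_lt.2 (max_le (h j) (h (j + 1)))), zero_mul]

/-- No vertex strictly to the right: `W₂ = 0`. [folklore] -/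
theorem W₂_eq_zero_of_fst_le {a b : ℤ} (h : ∀ j, (c.v j).1 ≤ a) : c.W₂ a b = 0 := by
  unfold W₂
  exact sum_eq_zero fun j _ => by
    rw [indZ_of_neg (not_lt.2 ((min_le_left _ _).trans (h j))), zero_mul]

/-- All vertices strictly to the right: `W₁ = 0` (telescoping). [folklore] -/
theorem W₁_eq_zero_of_lt_fst {a b : ℤ} (h : ∀ j, a < (c.v j).1) : c.W₁ a b = 0 := by
  unfold W₁
  rw [sum_congr rfl fun j _ => by rw [indZ_of_pos (lt_max_of_lt_left (h j)), one_mul],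
    sum_range_sub (fun j => indZ (b < (c.v j).2)), c.v_ℓ, sub_self]

/-- All vertices strictly to the right: `W₂ = 0` (telescoping). [folklore] -/
theorem W₂_eq_zero_of_lt_fst {a b : ℤ} (h : ∀ j, a < (c.v j).1) : c.W₂ a b = 0 := by
  unfold W₂
  rw [sum_congr rfl fun j _ => by rw [indZ_of_pos (lt_min (h j) (h (j + 1))), one_mul],
    sum_range_sub (fun j => indZ (b < (c.v j).2)), c.v_ℓ, sub_self]

/-- No vertex strictly above: `W₁ = 0`. [folklore] -/
theorem W₁_eq_zero_of_snd_le {a b : ℤ} (h : ∀ j, (c.v j).2 ≤ b) : c.W₁ a b = 0 := by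
  unfold W₁
  exact sum_eq_zero fun j _ => by
    rw [indZ_of_neg (not_lt.2 (h j)), indZ_of_neg (not_lt.2 (h (j + 1))), sub_self, mul_zero]

/-- No vertex strictly above: `W₂ = 0`. [folklore] -/
theorem W₂_eq_zero_of_snd_le {a b : ℤ} (h : ∀ j, (c.v j).2 ≤ b) : c.W₂ a b = 0 := by
  unfold W₂
  exact sum_eq_zero fun j _ => by
    rw [indZ_of_neg (not_lt.2 (h j)), indZ_of_neg (not_lt.2 (h (j + 1))), sub_self, mul_zero]

/-- All vertices strictly above: `W₁ = 0`. [folklore] -/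
theorem W₁_eq_zero_of_lt_snd {a b : ℤ} (h : ∀ j, b < (c.v j).2) : c.W₁ a b = 0 := by
  unfold W₁
  exact sum_eq_zero fun j _ => by rw [indZ_of_pos (h j), indZ_of_pos (h (j + 1)), sub_self, mul_zero]

/-- All vertices strictly above: `W₂ = 0`. [folklore] -/
theorem W₂_eq_zero_of_lt_snd {a b : ℤ} (h : ∀ j, b < (c.v j).2) : c.W₂ a b = 0 := by
  unfold W₂
  exact sum_eq_zero fun j _ => by rw [indZ_of_pos (h j), indZ_of_pos (h (j + 1)), sub_self, mul_zero]

/-- `W₁` is supported in the box of faces `[P₀, P₁) × [Q₀, Q₁)` spanned by the walk. [folklore] -/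
theorem W₁_eq_zero_of_notMem_box {P₀ P₁ Q₀ Q₁ : ℤ} (hX : ∀ j, P₀ ≤ (c.v j).1 ∧ (c.v j).1 ≤ P₁)
    (hY : ∀ j, Q₀ ≤ (c.v j).2 ∧ (c.v j).2 ≤ Q₁) {f : ℤ × ℤ} (hf : f ∉ Ico P₀ P₁ ×ˢ Ico Q₀ Q₁) :
    c.W₁ f.1 f.2 = 0 := by
  obtain ⟨p, q⟩ := f
  simp only [mem_product, mem_Ico, not_and_or, not_le, not_lt] at hf
  rcases hf with (h | h) | (h | h)
  · exact c.W₁_eq_zero_of_lt_fst fun j => lt_of_lt_of_le h (hX j).1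
  · exact c.W₁_eq_zero_of_fst_le fun j => (hX j).2.trans h
  · exact c.W₁_eq_zero_of_lt_snd fun j => lt_of_lt_of_le h (hY j).1
  · exact c.W₁_eq_zero_of_snd_le fun j => (hY j).2.trans h

/-- `W₂` is supported in the box of faces `[P₀, P₁) × [Q₀, Q₁)` spanned by the walk. [folklore] -/
theorem W₂_eq_zero_of_notMem_box {P₀ P₁ Q₀ Q₁ : ℤ} (hX : ∀ j, P₀ ≤ (c.v j).1 ∧ (c.v j).1 ≤ P₁)
    (hY : ∀ j, Q₀ ≤ (c.v j).2 ∧ (c.v j).2 ≤ Q₁) {f : ℤ × ℤ} (hf : f ∉ Ico P₀ P₁ ×ˢ Ico Q₀ Q₁) :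
    c.W₂ f.1 f.2 = 0 := by
  obtain ⟨p, q⟩ := f
  simp only [mem_product, mem_Ico, not_and_or, not_le, not_lt] at hf
  rcases hf with (h | h) | (h | h)
  · exact c.W₂_eq_zero_of_lt_fst fun j => lt_of_lt_of_le h (hX j).1
  · exact c.W₂_eq_zero_of_fst_le fun j => (hX j).2.trans h
  · exact c.W₂_eq_zero_of_lt_snd fun j => lt_of_lt_of_le h (hY j).1
  · exact c.W₂_eq_zero_of_snd_le fun j => (hY j).2.trans h

/-- Summing an indicator-weighted step over the box of faces: for `M ∈ [P₀, P₁]`,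
`Σ_{(a,b) ∈ box} [a < M] ([b < Y'] - [b < Y]) = (M - P₀) (Y' - Y)`. [folklore] -/
theorem sum_box_indZ_mul {P₀ P₁ Q₀ Q₁ M Y Y' : ℤ} (hM : P₀ ≤ M ∧ M ≤ P₁) (hY : Q₀ ≤ Y ∧ Y ≤ Q₁)
    (hY' : Q₀ ≤ Y' ∧ Y' ≤ Q₁) :
    ∑ f ∈ Ico P₀ P₁ ×ˢ Ico Q₀ Q₁, indZ (f.1 < M) * (indZ (f.2 < Y') - indZ (f.2 < Y)) =
      (M - P₀) * (Y' - Y) := by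
  rw [sum_product]
  have inner : ∀ p : ℤ, ∑ q ∈ Ico Q₀ Q₁, indZ ((p, q).1 < M) *
      (indZ ((p, q).2 < Y') - indZ ((p, q).2 < Y)) = indZ (p < M) * (Y' - Y) := by
    intro p
    show ∑ q ∈ Ico Q₀ Q₁, indZ (p < M) * (indZ (q < Y') - indZ (q < Y)) = _
    rw [← mul_sum, sum_sub_distrib, ClosedWalk.sum_Ico_indZ_lt hY'.1 hY'.2,
      ClosedWalk.sum_Ico_indZ_lt hY.1 hY.2]
    ring
  rw [sum_congr rfl fun p _ => inner p, ← sum_mul, ClosedWalk.sum_Ico_indZ_lt hM.1 hM.2]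

/-- **The winding numbers of all triangles sum to the shoelace sum** (each triangle has area `½`).
[folklore] -/
theorem sum_W_box_eq_shoelace {P₀ P₁ Q₀ Q₁ : ℤ} (hX : ∀ j, P₀ ≤ (c.v j).1 ∧ (c.v j).1 ≤ P₁)
    (hY : ∀ j, Q₀ ≤ (c.v j).2 ∧ (c.v j).2 ≤ Q₁) :
    ∑ f ∈ Ico P₀ P₁ ×ˢ Ico Q₀ Q₁, (c.W₁ f.1 f.2 + c.W₂ f.1 f.2) = c.shoelace := by
  unfold W₁ W₂
  simp only [sum_add_distrib]
  rw [sum_comm, sum_comm (s := Ico P₀ P₁ ×ˢ Ico Q₀ Q₁)]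
  have hmax : ∀ j, P₀ ≤ max (c.v j).1 (c.v (j + 1)).1 ∧ max (c.v j).1 (c.v (j + 1)).1 ≤ P₁ :=
    fun j => ⟨(hX j).1.trans (le_max_left _ _), max_le (hX j).2 (hX (j + 1)).2⟩
  have hmin : ∀ j, P₀ ≤ min (c.v j).1 (c.v (j + 1)).1 ∧ min (c.v j).1 (c.v (j + 1)).1 ≤ P₁ :=
    fun j => ⟨le_min (hX j).1 (hX (j + 1)).1, (min_le_left _ _).trans (hX j).2⟩
  rw [sum_congr rfl fun j _ => sum_box_indZ_mul (hmax j) (hY j) (hY (j + 1)),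
    sum_congr rfl fun j _ => sum_box_indZ_mul (hmin j) (hY j) (hY (j + 1)), ← sum_add_distrib]
  unfold shoelace
  have h0 : ∑ j ∈ range ℓ, ((c.v (j + 1)).2 - (c.v j).2) = 0 := by
    rw [sum_range_sub (fun j => (c.v j).2), c.v_ℓ, sub_self]
  have h1 : ∑ j ∈ range ℓ, ((c.v (j + 1)).1 * (c.v (j + 1)).2 - (c.v j).1 * (c.v j).2) = 0 := by
    rw [sum_range_sub (fun j => (c.v j).1 * (c.v j).2), c.v_ℓ, sub_self]
  have key : ∀ j, (max (c.v j).1 (c.v (j + 1)).1 - P₀) * ((c.v (j + 1)).2 - (c.v j).2) +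
      (min (c.v j).1 (c.v (j + 1)).1 - P₀) * ((c.v (j + 1)).2 - (c.v j).2) =
      ((c.v j).1 * (c.v (j + 1)).2 - (c.v (j + 1)).1 * (c.v j).2) +
        ((c.v (j + 1)).1 * (c.v (j + 1)).2 - (c.v j).1 * (c.v j).2) -
          2 * P₀ * ((c.v (j + 1)).2 - (c.v j).2) := by
    intro j
    have hsum : max (c.v j).1 (c.v (j + 1)).1 + min (c.v j).1 (c.v (j + 1)).1 =
        (c.v j).1 + (c.v (j + 1)).1 := max_add_min _ _
    linear_combination ((c.v (j + 1)).2 - (c.v j).2) * hsum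
  rw [sum_congr rfl fun j _ => key j, sum_sub_distrib, sum_add_distrib, h1, add_zero, ← mul_sum, h0,
    mul_zero, sub_zero]

/-- The sum of `W₁` over any finite set of faces containing the box spanned by the walk, plus the
same for `W₂`, is the shoelace sum. [folklore] -/
theorem sum_W_eq_shoelace {P₀ P₁ Q₀ Q₁ : ℤ} (hX : ∀ j, P₀ ≤ (c.v j).1 ∧ (c.v j).1 ≤ P₁)
    (hY : ∀ j, Q₀ ≤ (c.v j).2 ∧ (c.v j).2 ≤ Q₁) {T : Finset (ℤ × ℤ)}
    (hT : Ico P₀ P₁ ×ˢ Ico Q₀ Q₁ ⊆ T) :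
    ∑ f ∈ T, c.W₁ f.1 f.2 + ∑ f ∈ T, c.W₂ f.1 f.2 = c.shoelace := by
  rw [← c.sum_W_box_eq_shoelace hX hY, sum_add_distrib,
    ← sum_subset hT fun f _ hf => c.W₁_eq_zero_of_notMem_box hX hY hf,
    ← sum_subset hT fun f _ hf => c.W₂_eq_zero_of_notMem_box hX hY hf]

/-! ### The winding numbers counted on the upward ray (summation by parts) -/

/-- `W₁` on the upward ray: `W₁ a b = -Σ_j [b < max (y_j, y_{j+1})] ([a < x_{j+1}] - [a < x_j])`.
[folklore] -/
theorem W₁_eq_neg_sum (a b : ℤ) : c.W₁ a b =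
    -∑ j ∈ range ℓ, indZ (b < max (c.v j).2 (c.v (j + 1)).2) *
      (indZ (a < (c.v (j + 1)).1) - indZ (a < (c.v j).1)) := by
  unfold W₁
  rw [eq_neg_iff_add_eq_zero, ← sum_add_distrib]
  have htel : ∑ j ∈ range ℓ, (indZ (a < (c.v (j + 1)).1) * indZ (b < (c.v (j + 1)).2) -
      indZ (a < (c.v j).1) * indZ (b < (c.v j).2)) = 0 := by
    rw [sum_range_sub (fun j => indZ (a < (c.v j).1) * indZ (b < (c.v j).2)), c.v_ℓ, sub_self]
  rw [← htel]
  refine sum_congr rfl fun j _ => ?_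
  simp only [indZ_apply]
  rcases c.step_coord j with h | h | h | h | h | h <;>
    · rw [h.1, h.2]; split_ifs <;> omega

/-- `W₂` on the upward ray: `W₂ a b = -Σ_j [b < min (y_j, y_{j+1})] ([a < x_{j+1}] - [a < x_j])`.
[folklore] -/
theorem W₂_eq_neg_sum (a b : ℤ) : c.W₂ a b =
    -∑ j ∈ range ℓ, indZ (b < min (c.v j).2 (c.v (j + 1)).2) *
      (indZ (a < (c.v (j + 1)).1) - indZ (a < (c.v j).1)) := by
  unfold W₂
  rw [eq_neg_iff_add_eq_zero, ← sum_add_distrib]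
  have htel : ∑ j ∈ range ℓ, (indZ (a < (c.v (j + 1)).1) * indZ (b < (c.v (j + 1)).2) -
      indZ (a < (c.v j).1) * indZ (b < (c.v j).2)) = 0 := by
    rw [sum_range_sub (fun j => indZ (a < (c.v j).1) * indZ (b < (c.v j).2)), c.v_ℓ, sub_self]
  rw [← htel]
  refine sum_congr rfl fun j _ => ?_
  simp only [indZ_apply]
  rcases c.step_coord j with h | h | h | h | h | h <;>
    · rw [h.1, h.2]; split_ifs <;> omega

/-! ### Jumps across the three kinds of edges -/

/-- **Jump across a vertical edge** `(a,b)—(a,b+1)` (left: `T₂(a-1,b)`, right: `T₁(a,b)`):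
`W₁ a b - W₂ (a-1) b = -(cnt up - cnt down)`. [folklore] -/
theorem W₁_sub_W₂_left (a b : ℤ) :
    c.W₁ a b - c.W₂ (a - 1) b = -(c.cnt (a, b) (a, b + 1) - c.cnt (a, b + 1) (a, b)) := by
  unfold W₁ W₂ cnt
  rw [← sum_sub_distrib, ← sum_sub_distrib, ← sum_neg_distrib]
  refine sum_congr rfl fun j _ => ?_
  simp only [indZ_apply, Prod.ext_iff]
  rcases c.step_coord j with h | h | h | h | h | h <;>
    · rw [h.1, h.2]; split_ifs <;> omega

/-- **Jump across a horizontal edge** `(a,b)—(a+1,b)` (above: `T₁(a,b)`, below: `T₂(a,b-1)`):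
`W₁ a b - W₂ a (b-1) = cnt right - cnt left`. [folklore] -/
theorem W₁_sub_W₂_below (a b : ℤ) :
    c.W₁ a b - c.W₂ a (b - 1) = c.cnt (a, b) (a + 1, b) - c.cnt (a + 1, b) (a, b) := by
  rw [c.W₁_eq_neg_sum, c.W₂_eq_neg_sum]
  unfold cnt
  rw [neg_sub_neg, ← sum_sub_distrib, ← sum_sub_distrib]
  refine sum_congr rfl fun j _ => ?_
  simp only [indZ_apply, Prod.ext_iff]
  rcases c.step_coord j with h | h | h | h | h | h <;>
    · rw [h.1, h.2]; split_ifs <;> omega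

/-- **Jump across an antidiagonal** of the square `(a,b)` (lower left: `T₁(a,b)`, upper right:
`T₂(a,b)`): `W₁ a b - W₂ a b = cnt up-left - cnt down-right`. [folklore] -/
theorem W₁_sub_W₂_diag (a b : ℤ) :
    c.W₁ a b - c.W₂ a b = c.cnt (a + 1, b) (a, b + 1) - c.cnt (a, b + 1) (a + 1, b) := by
  unfold W₁ W₂ cnt
  rw [← sum_sub_distrib, ← sum_sub_distrib]
  refine sum_congr rfl fun j _ => ?_
  simp only [indZ_apply, Prod.ext_iff]
  rcases c.step_coord j with h | h | h | h | h | h <;>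
    · rw [h.1, h.2]; split_ifs <;> omega

/-! ### Traversal counts; the winding number off the walk -/

/-- The edges at an unvisited lattice point `u` are not traversed, in either direction. [folklore] -/
theorem cnt_eq_zero_of_notMem {u : ℤ × ℤ} (h : ∀ j, c.v j ≠ u) (Q : ℤ × ℤ) :
    c.cnt u Q = 0 ∧ c.cnt Q u = 0 :=
  ⟨sum_eq_zero fun j _ => indZ_of_neg fun hj => h j hj.1,
    sum_eq_zero fun j _ => indZ_of_neg fun hj => h (j + 1) hj.2⟩

/-- **Off the walk the six triangles around a lattice point have the same winding number**, that
of `T₁(u)`: the list `[W₂(a-1,b-1), W₁(a-1,b), W₁(a,b-1), W₂(a-1,b), W₂(a,b-1)]` all equal `W₁(a,b)`.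
[folklore] -/
theorem W_around_eq_of_notMem {a b : ℤ} (h : ∀ j, c.v j ≠ (a, b)) :
    c.W₂ (a - 1) (b - 1) = c.W₁ a b ∧ c.W₁ (a - 1) b = c.W₁ a b ∧ c.W₁ a (b - 1) = c.W₁ a b ∧
      c.W₂ (a - 1) b = c.W₁ a b ∧ c.W₂ a (b - 1) = c.W₁ a b := by
  -- edge up `(a,b) → (a,b+1)`: `T₂(a-1,b) | T₁(a,b)`
  have e1 : c.W₂ (a - 1) b = c.W₁ a b := by
    have := c.W₁_sub_W₂_left a b
    rw [(c.cnt_eq_zero_of_notMem h _).1, (c.cnt_eq_zero_of_notMem h _).2] at this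
    linarith
  -- edge right `(a,b) → (a+1,b)`: `T₁(a,b) | T₂(a,b-1)`
  have e2 : c.W₂ a (b - 1) = c.W₁ a b := by
    have := c.W₁_sub_W₂_below a b
    rw [(c.cnt_eq_zero_of_notMem h _).1, (c.cnt_eq_zero_of_notMem h _).2] at this
    linarith
  -- antidiagonal of square `(a-1,b)`: edge `(a,b) — (a-1,b+1)`: `T₁(a-1,b) | T₂(a-1,b)`
  have e3 : c.W₁ (a - 1) b = c.W₂ (a - 1) b := by
    have := c.W₁_sub_W₂_diag (a - 1) b
    rw [sub_add_cancel, (c.cnt_eq_zero_of_notMem h _).1, (c.cnt_eq_zero_of_notMem h _).2] at this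
    linarith
  -- antidiagonal of square `(a,b-1)`: edge `(a+1,b-1) — (a,b)`: `T₁(a,b-1) | T₂(a,b-1)`
  have e4 : c.W₁ a (b - 1) = c.W₂ a (b - 1) := by
    have := c.W₁_sub_W₂_diag a (b - 1)
    rw [sub_add_cancel, (c.cnt_eq_zero_of_notMem h _).2, (c.cnt_eq_zero_of_notMem h _).1] at this
    linarith
  -- edge left `(a-1,b) → (a,b)`: `T₁(a-1,b) | T₂(a-1,b-1)`
  have e5 : c.W₂ (a - 1) (b - 1) = c.W₁ (a - 1) b := by
    have := c.W₁_sub_W₂_below (a - 1) b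
    rw [sub_add_cancel, (c.cnt_eq_zero_of_notMem h _).2, (c.cnt_eq_zero_of_notMem h _).1] at this
    linarith
  refine ⟨?_, ?_, ?_, e1, e2⟩
  · rw [e5, e3, e1]
  · rw [e3, e1]
  · rw [e4, e2]

/-- Off the walk the angle-weighted face sum is `8 W₁`. [folklore] -/
theorem faceSum_eq_of_notMem {u : ℤ × ℤ} (h : ∀ j, c.v j ≠ u) : c.faceSum u = 8 * c.W₁ u.1 u.2 := by
  obtain ⟨a, b⟩ := u
  obtain ⟨e1, e2, e3, e4, e5⟩ := c.W_around_eq_of_notMem h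
  simp only [faceSum, e1, e2, e3, e4, e5]
  ring

/-- **Off the walk, lattice neighbours have the same winding number.** [folklore] -/
theorem W₁_eq_of_notMem {u u' : ℤ × ℤ} (hu : ∀ j, c.v j ≠ u) (hu' : ∀ j, c.v j ≠ u')
    (h : u' = u + (1, 0) ∨ u = u' + (1, 0) ∨ u' = u + (0, 1) ∨ u = u' + (0, 1) ∨
      u' = u + (1, -1) ∨ u = u' + (1, -1)) : c.W₁ u.1 u.2 = c.W₁ u'.1 u'.2 := by
  -- by symmetry it suffices to treat the neighbours to the right, above and below-right
  suffices key : ∀ w w' : ℤ × ℤ, (∀ j, c.v j ≠ w) → (∀ j, c.v j ≠ w') →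
      (w' = w + (1, 0) ∨ w' = w + (0, 1) ∨ w' = w + (1, -1)) → c.W₁ w.1 w.2 = c.W₁ w'.1 w'.2 by
    rcases h with h' | h' | h' | h' | h' | h'
    · exact key u u' hu hu' (Or.inl h')
    · exact (key u' u hu' hu (Or.inl h')).symm
    · exact key u u' hu hu' (Or.inr (Or.inl h'))
    · exact (key u' u hu' hu (Or.inr (Or.inl h'))).symm
    · exact key u u' hu hu' (Or.inr (Or.inr h'))
    · exact (key u' u hu' hu (Or.inr (Or.inr h'))).symm
  rintro ⟨a, b⟩ w' hw hw' (rfl | rfl | rfl)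
  · -- right neighbour `(a+1, b)`: common triangle `T₁(a,b) = T₁((a+1)-1, b)`
    obtain ⟨-, e2, -⟩ := c.W_around_eq_of_notMem (a := a + 1) (b := b) (by simpa using hw')
    simp only [Prod.fst_add, Prod.snd_add, add_zero]
    rw [← e2, add_sub_cancel_right]
  · -- upper neighbour `(a, b+1)`: common triangle `T₁(a,b) = T₁(a, (b+1)-1)`
    obtain ⟨-, -, e3, -⟩ := c.W_around_eq_of_notMem (a := a) (b := b + 1) (by simpa using hw')
    simp only [Prod.fst_add, Prod.snd_add, add_zero]
    rw [← e3, add_sub_cancel_right]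
  · -- lower-right neighbour `(a+1, b-1)`: common triangle `T₂(a, b-1) = T₂((a+1)-1, b-1)`
    obtain ⟨-, -, -, -, e5⟩ := c.W_around_eq_of_notMem (a := a) (b := b) hw
    obtain ⟨-, -, -, e4', -⟩ := c.W_around_eq_of_notMem (a := a + 1) (b := b - 1)
      (by simpa [sub_eq_add_neg] using hw')
    simp only [Prod.fst_add, Prod.snd_add]
    rw [show b + -1 = b - 1 by ring, ← e4', add_sub_cancel_right, e5]

end TriWalk

/-- **Off a closed triangular-lattice walk, lattice neighbours have the same winding number**
(closed form of `TriWalk.W₁_eq_of_notMem`; registered sub-goal `pickParity_offWalk_neighbours` of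
stmt-ValiantsHypothesis-5066, first milestone of stub `stub_pickParity`). [folklore] -/
theorem pickParity_offWalk_neighbours : ∀ {ℓ : ℕ} (c : Summit.ValiantsHypothesis.ValiantsHypothesis.Theorems.DivisionGapZeroOneTransfer.TriWalk ℓ) {u u' : ℤ × ℤ}, (∀ j, c.v j ≠ u) → (∀ j, c.v j ≠ u') → (u' = u + (1, 0) ∨ u = u' + (1, 0) ∨ u' = u + (0, 1) ∨ u = u' + (0, 1) ∨ u' = u + (1, -1) ∨ u = u' + (1, -1)) → c.W₁ u.1 u.2 = c.W₁ u'.1 u'.2 :=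
  fun c _ _ hu hu' h => c.W₁_eq_of_notMem hu hu' h

end Summit.ValiantsHypothesis.ValiantsHypothesis.Theorems.DivisionGapZeroOneTransfer
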